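import Summits.BirchSwinnertonDyer.BirchSwinnertonDyer.Theorems.ErratumRoadFiveRest3NoWitnessRung5595f1
import Summits.BirchSwinnertonDyer.BirchSwinnertonDyer.Theorems.ErratumRoadFiveRegCertRung5595f1
import HarnessLib

/-!
# Route `ErratumRoadFive` (rung K2, `p ≥ 5`), crux `Rest3NoWitnessBranchAtFive` (item stmt-BirchSwinnertonDyer-19703,
# the no-witness branch (NW) of REST‴ ∕ REST⁗): the BC5 rung at `(5595f1, 5)` from PUBLISHED named facts ALONE — the
# attested regulator certificate `hReg` of `rung_5595f1_of_regCert` (p453656) is now a kernel theorem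
# (cell `bsd-stepL`, seat `bsd-stepL-reg3-eng` g5; `--supports stmt-BirchSwinnertonDyer-19703 --as helper`)

HONEST FRAMING: THEOREMS ONLY (no definition, no named fact, no `sorry`, no `native_decide`; axioms standard); nothing is
booked; BSD is proved for no class; ONE curve; CONDITIONAL on the displayed PUBLISHED named facts (Gross–Zagier, Kolyvagin,
Skinner 2016 Thm. C ∕ Thm. A, GZK, modularity, Jetchev–Skinner–Wan 2017 Thm. 3.3.1, Stein–Wuthrich 2013 Thm. 6.1 ∕ §4.2,
Disegni 2020 Thm. 1, a modular parametrisation) and on NOTHING ELSE: the one non-published binder of seat rest-p2's rung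
`rung_5595f1_of_regCert` — `hReg : ClassClosure.RegulatorNonvanishingAt E 5`, "a finite `5`-adic computation attested by
kit j255562, not kernel-checked today" — is discharged INSIDE the predicate's binders by the seat's REG5CERT kernel
certificate `RegMult.Rung5595f1.regulatorNonvanishingAt_baseChange_of_GZK` (`Theorems/ErratumRoadFiveRegCertRung5595f1.lean`:
admissible point `Q = 15·(−5,4)`, Stein–Wuthrich §4.2 height non-zero for every `‖q‖₅ < 1` by ONE integer fact
`14⁸ − e'⁸ ≢ 0 (mod 5³)`, non-split at `5` decided on the integer model; GZK gives rank one inside `ClassX11b E 5`).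
Schneider's conjecture class-wide (the crux `stub_nw_*`'s content off this pair) is asserted NOWHERE.

* `rung_5595f1_of_kernelCert` — rest-p2's `rung_5595f1_of_regCert` with the binder `hReg` REMOVED (same proof, the
  certificate supplied by the kernel theorem): `P2OpenInputOnTreeAt E 5` at `E = (⟨1,0,0,−71,−234⟩ : WeierstrassCurve ℤ).baseChange ℚ`
  from published binders only — the registered statement of `stub_rung_nw_5595f1` modulo PUB;
* `rung_5595f1_of_items_of_kernelCert` — the same over the route's support items BY NAME (`PublishedInputsFive` 19066,
  `JSWAnticyclotomicControlMult` 19626) + the lever-fact conjunction (verbatim the (T) skeleton's fact-stub `stub_t_leverFacts`).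

PARTITION (D-0054): X11b@p≥5 (B9 ∕ N8) × the REST⁗ ∕ (NW) pair `(5595f1, 5)` × `p = 5 ∥ N = 5595` — types-the-object-of (the
rung's last non-published binder retired); closes: none (T7). This file is a LEAF (imports the route through rest-p2's rung
file); the certificate tower it rests on is route-free.
References: [Skinner2016PacificMC] Thm. A, Thm. C; [SteinWuthrich2013] Thm. 6.1, §4.2; [Disegni2020] Thm. 1;
[JetchevSkinnerWan2017] Thm. 3.3.1; [KolyvaginEulerSystems1990] Thm. A; [Cremona1997] (curve 5595f1).
-/

set_option autoImplicit false
-- the Theorems namespace of this sub repeats the summit name by design (D-0017 nested layout)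
set_option linter.dupNamespace false

open scoped Classical

open WeierstrassCurve
  Literature.NumberTheory.EllipticCurves Literature.NumberTheory.EllipticCurves.ModularForms
  Literature.NumberTheory.EllipticCurves.Rank1Residual
  Literature.NumberTheory.EllipticCurves.Rank1Residual.Typed
  Literature.NumberTheory.EllipticCurves.JetchevSkinnerWan2017
  Literature.NumberTheory.EllipticCurves.SteinWuthrich2013
  Literature.NumberTheory.EllipticCurves.Disegni2020
  Literature.NumberTheory.EllipticCurves.Skinner2016
  Summit.BirchSwinnertonDyer.Rank1Residual Summit.BirchSwinnertonDyer.Rank1Residual.X11b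
  Summit.BirchSwinnertonDyer.BirchSwinnertonDyer.Theses.ErratumRoadFive

namespace Summit.BirchSwinnertonDyer.BirchSwinnertonDyer.Theorems

/-- **BC5 RUNG at `(5595f1, 5)` from PUBLISHED named facts alone** (item 19703 `Rest3NoWitnessBranchAtFive`, registered
`stub_rung_nw_5595f1` = `stub_rung_rest4_5595f1` of 19624, modulo PUB): `P2OpenInputOnTreeAt E 5` for
`E = 5595f1 = (⟨1,0,0,−71,−234⟩ : WeierstrassCurve ℤ).baseChange ℚ`. Binders = those of rest-p2's `rung_5595f1_of_regCert` MINUS the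
attested certificate `hReg`, which is supplied inside the predicate's binders (`ClassX11b E 5` ⇒ rank one by GZK) by the
kernel theorem `RegMult.Rung5595f1.regulatorNonvanishingAt_baseChange_of_GZK` (REG5CERT: admissible `Q = 15·(−5,4)`, height
certificate `5³ ∤ 14⁸ − e'⁸`, non-split at `5`). Proof otherwise verbatim: the lever gives `BSD(E,5)`, tightness + JSW
control + the kernel-decided (ram) witness `373` give the open input. CONDITIONAL on the published binders; ONE curve;
nothing booked; Schneider class-wide asserted nowhere. [cite: Skinner2016PacificMC, Thm. A and Thm. C (§1)]
[cite: SteinWuthrich2013, Thm. 6.1 (p. 20), §4.2] [cite: Disegni2020, Thm. 1 (§1.2)] [cite: JetchevSkinnerWan2017, Thm. 3.3.1 and §7.4.1]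
[cite: KolyvaginEulerSystems1990, Thm. A] [cite: Cremona1997, Table 1 (curve 5595f1)] -/
theorem rung_5595f1_of_kernelCert
    [((⟨1, 0, 0, -71, -234⟩ : WeierstrassCurve ℤ).baseChange ℚ).IsElliptic]
    [((⟨1, 0, 0, -71, -234⟩ : WeierstrassCurve ℤ).baseChange ℚ).IsGloballyMinimal]
    -- published named facts (tightness + control)
    (hGZ : ∀ (N : ℕ) [NeZero N] (W : WeierstrassCurve ℚ) (K : Type) [Field K] [NumberField K],
      gross_zagier N W K)
    (hKo : ∀ (N : ℕ) [NeZero N] (W : WeierstrassCurve ℚ) (K : Type) [Field K] [NumberField K],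
      kolyvagin N W K)
    (hSk : Skinner2016.thmC_padicValRat_bsd_rank_zero)
    (hGZK : rank_eq_analyticRank_of_analyticRank_le_one) (hmod : hasEntireLFunction_rat)
    (h331 : thm331_anticyclotomicControl_mult)
    -- the lever's published facts
    (hSkA : thmA_charIdeal_multiplicative)
    (hJn : thm61_nonsplitMultiplicative) (hJs : thm61_splitMultiplicative)
    (hHn : exists_isMultCanonical) (hHs : exists_isSplitMultCanonical)
    (hD : thm1_padicBSD_rankOne_multiplicative) (hpar : nonempty_modularParametrizationData) :
    Summit.BirchSwinnertonDyer.Rank1Residual.X11b.P2OpenInputOnTreeAt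
      ((⟨1, 0, 0, -71, -234⟩ : WeierstrassCurve ℤ).baseChange ℚ) 5 := by
  refine p2OpenInputOnTreeAt_of_imp_surj _ 5 fun hX hp5 _ ↦ ?_
  exact P2.openInputOnTreeAt_of_bsdp_of_ram _ 5 hGZ hKo hSk hGZK hmod (p2ControlOnTreeAt_of_thm331Mult _ 5 h331 hKo)
    ram_five_5595f1
    (ClassClosure.bsdp_of_leverLocus_of_regulatorNonvanishing _ 5 hSkA hJn hJs hHn hHs hD hGZK hpar hX
      (ClassClosure.leverLocusAt_of_ram_of_five_le _ 5 ram_five_5595f1 hp5)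
      (RegMult.Rung5595f1.regulatorNonvanishingAt_baseChange_of_GZK hGZK hX))

/-- **The same over the route's support items BY NAME**: `PublishedInputsFive` (19066) + `JSWAnticyclotomicControlMult` (19626)
+ the lever-fact conjunction (verbatim the (T) skeleton's fact-stub `stub_t_leverFacts`) ⟹ the registered statement of
`stub_rung_nw_5595f1` ∕ `stub_rung_rest4_5595f1` — with NO certificate binder. CONDITIONAL on the published items; ONE curve.
[cite: Skinner2016PacificMC, Thm. A (§1)] [cite: SteinWuthrich2013, Thm. 6.1, §4.2] [cite: Disegni2020, Thm. 1 (§1.2)] -/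
theorem rung_5595f1_of_items_of_kernelCert
    [((⟨1, 0, 0, -71, -234⟩ : WeierstrassCurve ℤ).baseChange ℚ).IsElliptic]
    [((⟨1, 0, 0, -71, -234⟩ : WeierstrassCurve ℤ).baseChange ℚ).IsGloballyMinimal]
    (hF : PublishedInputsFive) (h331 : JSWAnticyclotomicControlMult)
    (hL : thmA_charIdeal_multiplicative ∧ thm61_nonsplitMultiplicative ∧ thm61_splitMultiplicative ∧
      exists_isMultCanonical ∧ exists_isSplitMultCanonical ∧ thm1_padicBSD_rankOne_multiplicative ∧
      nonempty_modularParametrizationData) :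
    Summit.BirchSwinnertonDyer.Rank1Residual.X11b.P2OpenInputOnTreeAt
      ((⟨1, 0, 0, -71, -234⟩ : WeierstrassCurve ℤ).baseChange ℚ) 5 := by
  obtain ⟨hGZ, hKo, -, hSk, -, hGZK, hmod, -, -, -, -, -, -, -, -⟩ := hF
  obtain ⟨hSkA, hJn, hJs, hHn, hHs, hD, hpar⟩ := hL
  exact rung_5595f1_of_kernelCert hGZ hKo hSk hGZK hmod h331 hSkA hJn hJs hHn hHs hD hpar

end Summit.BirchSwinnertonDyer.BirchSwinnertonDyer.Theorems
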